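/-
Copyright (c) 2026 the pub-hodgecm-mathlib formalisation cell (harness21).  Prover seat hodgecm-mathlib-K2Liu-p02 (g0),
Track B «K2-LIT» ∕ hLiu418 #184♮, unit U4 «POLE AND SEE-SAW» of the K2_Liu road, socket #17: payment of
`K2LiuCurveThetaSigsU4PoleAndSeesaw.sig_K2LiuPairingPoleTransfer` — (O4) POLE TRANSFER OVER GL₁.  2026-09-03.
-/
import Literature.NumberTheory.Automorphic.PairLFunctionPolesGLOneBoundaryUnconditional
import Literature.NumberTheory.Automorphic.PairLFunctionPolesGLOneDedekindProofs
import Literature.NumberTheory.GaloisRepresentations.HeckeCharacter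
import Literature.NumberTheory.GaloisRepresentations.ArtinLFunctionOrderAtOne   -- ★ `neBot_nhdsWithin_one_lt_re`, `nhdsWithin_one_lt_re_le_nhdsNE`
import Summits.HodgeConjecture.HodgeConjecture.Theorems.K2LiuThetaTypePartialLPole
import HarnessLib

/-!
# K2_Liu road (hLiu418 = stmt-HodgeConjecture-24832), unit U4 «POLE AND SEE-SAW», socket #17:
# (O4) pole transfer over GL₁ — `Z(s) = r(s) · ζ^S_K(s+½) L^S(s+½, ψ)` continues to `U ∖ {½}` with
# `(s − ½)^k Z^c(s) → r(½) · c`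

Cell `pub/hodgecm-mathlib` (D-0151), Track B (21-frontier RULING «PUSH BOTH» 2026-09-03; LEAD F0P6-plan DEAL BY NAME
2026-09-03T21:22:40Z: #17 ↦ base K2Liu-p02), socket module
`Summits/HodgeConjecture/HodgeConjecture/Cruxes/HLiu418/Lines/K2_Liu_CurveThetaSigs_U4_PoleAndSeesaw.lean` ED. 1 (planner K2Liu-plan
(g0), sha16 648f593eadb1b5cb), socket **`sig_K2LiuPairingPoleTransfer`** (#17, M, in-house) = the tier-0 line's stub s4
`stub_pairingPoleTransfer : PairingPoleTransfer` BY VALUE.  For a unitary Hecke character `ψ` of `K` trivial on the diagonal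
positive reals and unramified off the finite `S`, with `P(s) := ζ^S_K(s) · L^S(s, ψ) = ∏'_{v ∉ S} [(1 − q_v^{−s})(1 − ψ(ϖ_v) q_v^{−s})]⁻¹`:
if `Z = r · P(· + ½)` on `Re s > s₁ ≥ 1`, `r` holomorphic on an open preconnected `U ∋ ½` containing that half-plane, `r(½) ≠ 0`,
and `(s − 1)^k P(s) → c ≠ 0` as `s → 1` inside `Re s > 1` (`k ≥ 1`), then `Z` has a continuation `Z^c`, holomorphic on
`U ∖ {½}`, equal to `Z` on `Re s > s₁`, with `(s − ½)^k Z^c(s) → r(½) · c` on the punctured neighbourhood of `½`.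

THE MATHEMATICS (frame-free complex analysis over the tree's GL₁ continuation).
1. CONTINUATION (`exists_continuation_partialZetaL`): `P` extends to `G` holomorphic on `ℂ ∖ {1}`: `ζ^S_K(s) = ζ_K(s) · ∏_{v ∈ S}
   (1 − q_v^{−s})` (★ `tprod_eulerFactor_one_eq_dedekindZetaCont_mul_prod`, Hecke's continuation ★ `dedekindZetaCont`, holomorphic
   off `1` by ★ `isDedekindZetaContinuation_dedekindZetaCont_holds`), times Hecke's ENTIRE `L^S(s, ψ)` for `ψ ≠ 1` (★
   `exists_entire_forall_ne_zero_eq_partialHeckeL`, zero-free on `Re s = 1`), resp. times `ζ^S_K` again for `ψ = 1`; the split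
   `P = ζ^S · L^S` on `Re s > 1` is ★ `K2LiuThetaTypePartialLPole.tprod_zetaFactor_mul_heckeFactor_eq` (file #2, K2Liu-p01).  With
   `m = 1` (`ψ ≠ 1`) resp. `m = 2` (`ψ = 1`): `(s − 1)^m G(s) → L ≠ 0` on the PUNCTURED neighbourhood of `1` (simple pole of `ζ_K`,
   ★ `tendsto_sub_one_mul_dedekindZetaCont_holds`, residue `> 0`; `L = res·E(1)·g(1)` resp. `(res·E(1))²`).
2. POLE ORDER IS UNIQUE (`pole_order_unique`, pure filter algebra): since `𝓝[Re s > 1] 1 ≠ ⊥` (★ `neBot_nhdsWithin_one_lt_re`)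
   and `(s − 1)^k G(s) → c ≠ 0` there, necessarily `k = m` and `c = L` (if `k > m` the limit
   would be `0`; if `k < m` then `L = 0`).
3. TRANSFER: `Z^c(s) := r(s) · G(s + ½)` — holomorphic on `U ∖ {½}` (`s ≠ ½ ⇒ s + ½ ≠ 1`), `= Z` on `Re s > s₁` (there
   `Re (s + ½) > 1`), and `(s − ½)^k Z^c(s) = r(s) · [(t − 1)^k G(t)]_{t = s + ½} → r(½) · L = r(½) · c` along `𝓝[≠] ½`
   (translation maps `𝓝[≠] ½` to `𝓝[≠] 1`).  No removable-singularity theorem is needed.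
DEGENERATE CORNERS (socket docstring): `S = ∅` fine; `k = 0` excluded by `1 ≤ k` (not even used: `c ≠ 0` and `L ≠ 0` pin `k = m`);
`U` need not be connected for THIS construction (`IsPreconnected U` is carried, unused: `Z^c` is given by a closed formula).

* §1 `pole_order_unique` (complex-analysis bookkeeping; the filter facts `𝓝[Re s > 1] 1 ≠ ⊥`, `≤ 𝓝[≠] 1` are ★
  `neBot_nhdsWithin_one_lt_re` ∕ `nhdsWithin_one_lt_re_le_nhdsNE` of `ArtinLFunctionOrderAtOne`, imported).
* §2 `exists_continuation_partialZetaL` (the GL₁ continuation of `ζ^S_K · L^S(ψ)` with its pole datum `(m, L)`).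
* §3 **`pairingPoleTransfer`** — `sig_K2LiuPairingPoleTransfer` TOKEN FOR TOKEN.

HONEST LABEL: HC_CM is proved only modulo the 7 printed citations (2 remaining named inputs: hLiu418 = stmt-HodgeConjecture-24832,
h413 = stmt-HodgeConjecture-24833) until rung 0 closes; this file is a `--supports stmt-HodgeConjecture-24832` helper (floored
scaffold of the K2_Liu road; it discharges the line's stub s4 BY VALUE) and retires nothing by itself.
-/

noncomputable section

open scoped Topology NNReal
open NumberField IsDedekindDomain Filter Complex Set
open Literature.NumberTheory
open Literature.NumberTheory.GaloisRepresentations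
open Literature.NumberTheory.Automorphic

namespace Summit.HodgeConjecture.HodgeConjecture.Cruxes.HLiu418.K2LiuPairingPoleTransfer

/-! ## §1  Complex-analysis bookkeeping at `s = 1` -/

/-- **The order of a pole is unique** (pure filter algebra): if `(t − 1)^m G(t) → L ≠ 0` on the punctured neighbourhood of `1`
and `(t − 1)^k G(t) → c ≠ 0` along a non-trivial filter `l ≤ 𝓝[≠] 1`, then `k = m` and `c = L` (`k > m` would give limit `0`,
`k < m` would force `L = 0`; then uniqueness of limits in `l`). [cite: JacquetShalika1981, Thm. 4.4] -/
theorem pole_order_unique {G : ℂ → ℂ} {m k : ℕ} {L c : ℂ} {l : Filter ℂ} [l.NeBot] (hl : l ≤ 𝓝[≠] (1 : ℂ))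
    (hm : Tendsto (fun t : ℂ => (t - 1) ^ m * G t) (𝓝[≠] 1) (𝓝 L)) (hL : L ≠ 0)
    (hk : Tendsto (fun t : ℂ => (t - 1) ^ k * G t) l (𝓝 c)) (hc : c ≠ 0) : k = m ∧ c = L := by
  have h0 : Tendsto (fun t : ℂ => t - 1) l (𝓝 0) := by
    have h : Tendsto (fun t : ℂ => t - 1) (𝓝 1) (𝓝 ((1 : ℂ) - 1)) :=
      (continuous_id.sub continuous_const).tendsto 1
    rw [sub_self] at h
    exact h.mono_left (hl.trans nhdsWithin_le_nhds)
  have hml : Tendsto (fun t : ℂ => (t - 1) ^ m * G t) l (𝓝 L) := hm.mono_left hl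
  rcases lt_trichotomy k m with hkm | hkm | hkm
  · -- `k < m`: `(t-1)^m G = (t-1)^(m-k) · ((t-1)^k G) → 0 · c`, contradicting `L ≠ 0`
    exfalso
    have h1 : Tendsto (fun t : ℂ => (t - 1) ^ (m - k) * ((t - 1) ^ k * G t)) l (𝓝 ((0 : ℂ) ^ (m - k) * c)) :=
      (h0.pow (m - k)).mul hk
    rw [zero_pow (Nat.sub_ne_zero_of_lt hkm), zero_mul] at h1
    have h2 : Tendsto (fun t : ℂ => (t - 1) ^ m * G t) l (𝓝 0) :=
      h1.congr' (Eventually.of_forall fun t => by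
        show (t - 1) ^ (m - k) * ((t - 1) ^ k * G t) = (t - 1) ^ m * G t
        rw [← mul_assoc, ← pow_add, Nat.sub_add_cancel hkm.le])
    exact hL (tendsto_nhds_unique hml h2)
  · subst hkm
    exact ⟨rfl, tendsto_nhds_unique hk hml⟩
  · -- `m < k`: `(t-1)^k G = (t-1)^(k-m) · ((t-1)^m G) → 0 · L`, contradicting `c ≠ 0`
    exfalso
    have h1 : Tendsto (fun t : ℂ => (t - 1) ^ (k - m) * ((t - 1) ^ m * G t)) l (𝓝 ((0 : ℂ) ^ (k - m) * L)) :=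
      (h0.pow (k - m)).mul hml
    rw [zero_pow (Nat.sub_ne_zero_of_lt hkm), zero_mul] at h1
    have h2 : Tendsto (fun t : ℂ => (t - 1) ^ k * G t) l (𝓝 0) :=
      h1.congr' (Eventually.of_forall fun t => by
        show (t - 1) ^ (k - m) * ((t - 1) ^ m * G t) = (t - 1) ^ k * G t
        rw [← mul_assoc, ← pow_add, Nat.sub_add_cancel hkm.le])
    exact hc (tendsto_nhds_unique hk h2)

/-! ## §2  The GL₁ continuation of `ζ^S_K(s) · L^S(s, ψ)` and its pole datum at `s = 1` -/

section GLOne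

variable {K : Type} [Field K] [NumberField K]

/-- `1(ϖ_v) = 1` for the trivial Hecke character (the tree keeps this private in each sibling; a private copy again). [folklore] -/
private theorem valueAtUniformizer_one_K2Liu17 (v : HeightOneSpectrum (𝓞 K)) :
    (1 : HeckeCharacter K).valueAtUniformizer v = 1 := by
  rw [HeckeCharacter.valueAtUniformizer, HeckeCharacter.localComponent_apply, HeckeCharacter.one_apply, Units.val_one]

/-- **The continuation of `P(s) = ζ^S_K(s) · L^S(s, ψ)` to `ℂ ∖ {1}` with its pole datum.**  For unitary `ψ` trivial on `A_G`
and unramified off the finite `S` there are `G : ℂ → ℂ` holomorphic on `ℂ ∖ {1}`, `m ∈ ℕ` and `L ≠ 0` with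
`G = ∏'_{v ∉ S} [(1 − q_v^{−s})(1 − ψ(ϖ_v) q_v^{−s})]⁻¹` on `Re s > 1` and `(s − 1)^m G(s) → L` on the PUNCTURED neighbourhood of
`1`: `G = ζ_K · E_S · g` (`E_S(s) = ∏_{v ∈ S}(1 − q_v^{−s})`; `g` = Hecke's entire `L^S(·, ψ)` if `ψ ≠ 1`, ★
`exists_entire_forall_ne_zero_eq_partialHeckeL`, zero-free on `Re s = 1`; `g = ζ_K · E_S` if `ψ = 1`), `m = 1` resp. `2`,
`L = res_K E_S(1) g(1)` resp. `(res_K E_S(1))²` (Hecke 1917: ★ `tendsto_sub_one_mul_dedekindZetaCont_holds`, `res_K > 0`).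
[cite: NeukirchANT1999, Ch. VII (5.2), (5.11)] [cite: Iwasawa2019, Thm. 3.1 and Ch. 4 §4.2 Prop. 4.4] -/
theorem exists_continuation_partialZetaL (ψ : HeckeCharacter K) (hu : ψ.IsUnitary)
    (hA : ∀ t : ℝ≥0ˣ, ψ (posRealIdele K t) = 1) {S : Set (HeightOneSpectrum (𝓞 K))} (hS : S.Finite)
    (hur : ∀ v ∉ S, ψ.IsUnramifiedAt v) :
    ∃ (G : ℂ → ℂ) (m : ℕ) (L : ℂ), DifferentiableOn ℂ G {1}ᶜ ∧ L ≠ 0 ∧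
      Tendsto (fun t : ℂ => (t - 1) ^ m * G t) (𝓝[≠] 1) (𝓝 L) ∧
      ∀ t : ℂ, 1 < t.re → G t = ∏' v : {v : HeightOneSpectrum (𝓞 K) // v ∉ S},
        ((1 - ((v.1.residueCard : ℂ) ^ (-t)))⁻¹ * (1 - ψ.valueAtUniformizer v.1 * ((v.1.residueCard : ℂ) ^ (-t)))⁻¹) := by
  classical
  -- Hecke's continuation of `ζ_K` and its simple pole
  have hζd : DifferentiableOn ℂ (LFunctions.dedekindZetaCont K) {1}ᶜ :=
    (LFunctions.NumberField.isDedekindZetaContinuation_dedekindZetaCont_holds K).differentiableOn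
  have hζ1 : Tendsto (fun t : ℂ => (t - 1) * LFunctions.dedekindZetaCont K t) (𝓝[≠] 1)
      (𝓝 (NumberField.dedekindZeta_residue K : ℂ)) :=
    LFunctions.tendsto_sub_one_mul_dedekindZetaCont_holds K
  have hres : (NumberField.dedekindZeta_residue K : ℂ) ≠ 0 := by
    exact_mod_cast NumberField.dedekindZeta_residue_ne_zero K
  -- the finitely many Euler factors at `S`
  set E : ℂ → ℂ := fun t => ∏ v ∈ hS.toFinset, (1 - ((v.residueCard : ℂ) ^ (-t))) with hE
  have hEd : Differentiable ℂ E := Differentiable.fun_finsetProd fun v _ =>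
    (differentiable_const _).sub (differentiable_id.neg.const_cpow
      (Or.inl (Nat.cast_ne_zero.2 (ne_of_gt (lt_trans zero_lt_one v.one_lt_residueCard)))))
  have hE1 : E 1 ≠ 0 := Finset.prod_ne_zero_iff.2 fun v _ =>
    one_sub_residueCard_cpow_neg_ne_zero v (by rw [Complex.one_re]; exact one_pos)
  have hEt : Tendsto E (𝓝[≠] 1) (𝓝 (E 1)) := (hEd.continuous.tendsto 1).mono_left nhdsWithin_le_nhds
  -- `ζ^S_K = ζ_K · E_S` on `Re s > 1`
  have hζS : ∀ t : ℂ, 1 < t.re →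
      ∏' v : {v : HeightOneSpectrum (𝓞 K) // v ∉ S}, (1 - ((v.1.residueCard : ℂ) ^ (-t)))⁻¹ =
        LFunctions.dedekindZetaCont K t * E t :=
    fun t ht => tprod_eulerFactor_one_eq_dedekindZetaCont_mul_prod hS ht
  by_cases h1 : ψ = 1
  · -- `ψ = 1`: `P = (ζ^S_K)²`, double pole
    subst h1
    have hψ1 : ∀ t : ℂ, (∏' v : {v : HeightOneSpectrum (𝓞 K) // v ∉ S},
        (1 - (1 : HeckeCharacter K).valueAtUniformizer v.1 * ((v.1.residueCard : ℂ) ^ (-t)))⁻¹) =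
          ∏' v : {v : HeightOneSpectrum (𝓞 K) // v ∉ S}, (1 - ((v.1.residueCard : ℂ) ^ (-t)))⁻¹ :=
      fun t => tprod_congr fun v => by rw [valueAtUniformizer_one_K2Liu17, one_mul]
    refine ⟨fun t => (LFunctions.dedekindZetaCont K t * E t) * (LFunctions.dedekindZetaCont K t * E t), 2,
      ((NumberField.dedekindZeta_residue K : ℂ) * E 1) * ((NumberField.dedekindZeta_residue K : ℂ) * E 1),
      (hζd.mul hEd.differentiableOn).mul (hζd.mul hEd.differentiableOn),
      mul_ne_zero (mul_ne_zero hres hE1) (mul_ne_zero hres hE1), ?_, fun t ht => ?_⟩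
    · refine ((hζ1.mul hEt).mul (hζ1.mul hEt)).congr' (Eventually.of_forall fun t => ?_)
      show (t - 1) * LFunctions.dedekindZetaCont K t * E t * ((t - 1) * LFunctions.dedekindZetaCont K t * E t) =
        (t - 1) ^ 2 * (LFunctions.dedekindZetaCont K t * E t * (LFunctions.dedekindZetaCont K t * E t))
      ring
    · rw [K2LiuThetaTypePartialLPole.tprod_zetaFactor_mul_heckeFactor_eq hu S ht, hψ1 t, hζS t ht]
  · -- `ψ ≠ 1`: `P = ζ^S_K · L^S(ψ)` with `L^S(ψ)` entire and zero-free on `Re s = 1`, simple pole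
    obtain ⟨g, hg, hg1, hgeq⟩ := exists_entire_forall_ne_zero_eq_partialHeckeL ψ hu hA h1 hS hur
    have hgt : Tendsto g (𝓝[≠] 1) (𝓝 (g 1)) := (hg.continuous.tendsto 1).mono_left nhdsWithin_le_nhds
    refine ⟨fun t => LFunctions.dedekindZetaCont K t * E t * g t, 1,
      (NumberField.dedekindZeta_residue K : ℂ) * E 1 * g 1,
      (hζd.mul hEd.differentiableOn).mul hg.differentiableOn,
      mul_ne_zero (mul_ne_zero hres hE1) (hg1 1 Complex.one_re), ?_, fun t ht => ?_⟩
    · refine ((hζ1.mul hEt).mul hgt).congr' (Eventually.of_forall fun t => ?_)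
      show (t - 1) * LFunctions.dedekindZetaCont K t * E t * g t = (t - 1) ^ 1 * (LFunctions.dedekindZetaCont K t * E t * g t)
      ring
    · rw [K2LiuThetaTypePartialLPole.tprod_zetaFactor_mul_heckeFactor_eq hu S ht, hζS t ht, ← hgeq t ht]

end GLOne

/-! ## §3  The head -/

/-- **PAYMENT OF `sig_K2LiuPairingPoleTransfer`** (socket #17 of unit U4 «POLE AND SEE-SAW» of the K2_Liu road,
`Cruxes/HLiu418/Lines/K2_Liu_CurveThetaSigs_U4_PoleAndSeesaw.lean` ED. 1, TOKEN FOR TOKEN; = the tier-0 line's stub s4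
`PairingPoleTransfer` BY VALUE).  **(O4) POLE TRANSFER over GL₁**: with `P = ζ^S_K · L^S(·, ψ)`, if `Z = r · P(· + ½)` on
`Re s > s₁ ≥ 1`, `r` holomorphic on the open `U ∋ ½` containing that half-plane, `r(½) ≠ 0`, and `(s − 1)^k P(s) → c ≠ 0` inside
`Re s > 1`, then `Z^c(s) := r(s) · G(s + ½)` (`G` = the GL₁ continuation of `P`, §2) is holomorphic on `U ∖ {½}`, equals `Z` on
`Re s > s₁`, and `(s − ½)^k Z^c(s) → r(½) · c` along `𝓝[≠] ½` (§1: the hypothesis pins `k` to the true pole order and `c` to the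
true leading coefficient). [cite: JacquetShalika1981, Thm. 4.4] [cite: Liu2021, App. B Cor. B.5 (3) p. 98]
[cite: NeukirchANT1999, Ch. VII (5.11)] -/
theorem pairingPoleTransfer :
    ∀ (K : Type) [Field K] [NumberField K] (ψ : HeckeCharacter K), ψ.IsUnitary → (∀ t : ℝ≥0ˣ, ψ (posRealIdele K t) = 1) →
    ∀ (S : Set (HeightOneSpectrum (𝓞 K))), S.Finite → (∀ v ∉ S, ψ.IsUnramifiedAt v) →
    ∀ (Z r : ℂ → ℂ) (U : Set ℂ) (s₁ : ℝ), IsOpen U → IsPreconnected U → (1 / 2 : ℂ) ∈ U → (1 : ℝ) ≤ s₁ → {s : ℂ | s₁ < s.re} ⊆ U →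
      DifferentiableOn ℂ r U → r (1 / 2) ≠ 0 →
      (∀ s : ℂ, s₁ < s.re → Z s = r s *
        ∏' v : {v : HeightOneSpectrum (𝓞 K) // v ∉ S},
          ((1 - ((v.1.residueCard : ℂ) ^ (-(s + 1 / 2))))⁻¹ *
            (1 - ψ.valueAtUniformizer v.1 * ((v.1.residueCard : ℂ) ^ (-(s + 1 / 2))))⁻¹)) →
    ∀ (k : ℕ) (c : ℂ), 1 ≤ k → c ≠ 0 →
      Filter.Tendsto (fun s : ℂ => (s - 1) ^ k *
        ∏' v : {v : HeightOneSpectrum (𝓞 K) // v ∉ S},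
          ((1 - ((v.1.residueCard : ℂ) ^ (-s)))⁻¹ * (1 - ψ.valueAtUniformizer v.1 * ((v.1.residueCard : ℂ) ^ (-s)))⁻¹))
        (𝓝[{s : ℂ | 1 < s.re}] 1) (𝓝 c) →
      ∃ Zc : ℂ → ℂ, DifferentiableOn ℂ Zc (U \ {(1 / 2 : ℂ)}) ∧ (∀ s : ℂ, s₁ < s.re → Zc s = Z s) ∧
        Filter.Tendsto (fun s : ℂ => (s - 1 / 2) ^ k * Zc s) (𝓝[≠] (1 / 2)) (𝓝 (r (1 / 2) * c)) := by
  intro K _ _ ψ hu hA S hS hur Z r U s₁ hUo _hUc h12 hs₁ _hsub hr _hr0 hZ k c _hk hc hlim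
  obtain ⟨G, m, L, hG, hL, hm, hGeq⟩ := exists_continuation_partialZetaL ψ hu hA hS hur
  -- the hypothesis, transported to the continuation `G`, pins `k = m` and `c = L`
  have hlim' : Tendsto (fun t : ℂ => (t - 1) ^ k * G t) (𝓝[{s : ℂ | 1 < s.re}] 1) (𝓝 c) :=
    hlim.congr' (eventually_nhdsWithin_of_forall fun t ht => by rw [← hGeq t ht])
  haveI := neBot_nhdsWithin_one_lt_re
  obtain ⟨hkm, hcL⟩ := pole_order_unique nhdsWithin_one_lt_re_le_nhdsNE hm hL hlim' hc
  subst hkm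
  subst hcL
  refine ⟨fun s => r s * G (s + 1 / 2), ?_, fun s hs => ?_, ?_⟩
  · -- holomorphy on `U ∖ {½}`: `s ≠ ½ ⇒ s + ½ ≠ 1`
    refine (hr.mono fun x hx => hx.1).mul (hG.comp (differentiableOn_id.add (differentiableOn_const _)) fun s hs => ?_)
    intro h1
    have h1' : s + 1 / 2 = (1 : ℂ) := h1
    exact hs.2 (show s = 1 / 2 by linear_combination h1')
  · -- agreement with `Z` on `Re s > s₁` (there `Re (s + ½) > 1`)
    have hs1 : 1 < (s + 1 / 2 : ℂ).re := by
      simp only [Complex.add_re, Complex.div_ofNat_re, Complex.one_re]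
      linarith
    show r s * G (s + 1 / 2) = Z s
    rw [hGeq _ hs1, hZ s hs]
  · -- the leading term at `½`, by translation `s ↦ s + ½ : 𝓝[≠] ½ → 𝓝[≠] 1`
    have hrc : Tendsto r (𝓝[≠] (1 / 2)) (𝓝 (r (1 / 2))) :=
      (hr.differentiableAt (hUo.mem_nhds h12)).continuousAt.tendsto.mono_left nhdsWithin_le_nhds
    have htr : Tendsto (fun s : ℂ => s + 1 / 2) (𝓝[≠] (1 / 2)) (𝓝[≠] 1) := by
      refine tendsto_nhdsWithin_of_tendsto_nhds_of_eventually_within _ ?_ ?_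
      · have h : Tendsto (fun s : ℂ => s + 1 / 2) (𝓝 (1 / 2)) (𝓝 ((1 / 2 : ℂ) + 1 / 2)) :=
          (continuous_id.add continuous_const).tendsto (1 / 2)
        rw [show (1 / 2 : ℂ) + 1 / 2 = 1 by norm_num] at h
        exact h.mono_left nhdsWithin_le_nhds
      · refine eventually_nhdsWithin_of_forall fun s hs h1 => hs ?_
        have h1' : s + 1 / 2 = (1 : ℂ) := h1
        show s = 1 / 2
        linear_combination h1'
    refine ((hrc.mul (hm.comp htr)).congr' (Eventually.of_forall fun s => ?_))
    show r s * ((s + 1 / 2 - 1) ^ k * G (s + 1 / 2)) = (s - 1 / 2) ^ k * (r s * G (s + 1 / 2))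
    ring

end Summit.HodgeConjecture.HodgeConjecture.Cruxes.HLiu418.K2LiuPairingPoleTransfer

end
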